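import Literature.Geometry.Symplectic.LegendrianRealisation
import Literature.Topology.FourManifolds.HandleAttachingMaps
import HarnessLib

/-!
# Eliashberg's theorem, part II: Stein structures extend over 2-handles attached along
# Legendrian knots with framing `tb - 1`

Topic `Literature/Geometry/Symplectic`; the central sub-result below Theorem 3 of
Akbulut–Matveyev (1998) (`AkbulutMatveyev.lean`, fact `Literature.Geometry.Symplectic.akbulut_matveyev`,
XL), recorded as ONE named fact now that 4-dimensional 2-handle attachment *along a prescribed
attaching map* exists in the tree (`Topology/FourManifolds/HandleAttachingMaps.lean`:
`HandleAttachingMap 3 2 W` = Kosinski's `h̄ : T → W`, `HandleAttachingMap.IsMultiAttachment h P`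
= "`P` is `W` with 2-handles attached simultaneously along the `h i`",
`HandleAttachingMap.attachingCircle` = Kirby's knot `f(S¹ × 0) ⊆ ∂W`,
`HandleAttachingMap.attachingFraming` = the product framing `f(S¹ × e₁)` induced by the handle).
The contact side is `SteinBoundaryContact.lean` (`IsLegendrianKnot`, the twisting number
`SteinStructure.twisting S K ν ∈ ℤ` of a framing relative to the canonical framing — its sign
pinned on the model by `SteinBallLegendrian.lean`: the Seifert framing of the standard
Legendrian unknot has twisting `+1`, i.e. `tb = -1` — and `SteinStructure.defect = max{twisting + 1, 0}`).

Sources, as printed.  Akbulut–Matveyev (1998), Thm. 2 (Eliashberg; "see also [G]"): *"Let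
`X = B⁴ ∪ (1-handles) ∪ (2-handles)` be four-dimensional handlebody with one 0-handle and no 3-
or 4-handles. Then: • The standard PC structure on `B⁴` can be extended over 1-handles, so that
manifold `X₁ = B⁴ ∪ (1-handles)` has pseudo-convex boundary. • If each 2-handle is attached to
`∂X₁` along a Legendrian knot with framing one less then Thurston–Bennequin framing of this
knot, then the complex structure on `X₁` can be extended over 2-handles to a complex structure
on `X`, which makes `X` a PC manifold."*  §3: *"Let `Z` be a PC manifold and `h` be a two
handle attached to `∂Z` along a Legendrian knot `K ⊂ ∂Z` with framing `f`. If `tb(K) ≥ f + 1`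
then by `C⁰`-small smooth isotopy of `K` we can decrease Thurston–Bennequin invariant of `K` and
make it equal to `f + 1`. Therefore, by a theorem of Eliashberg, manifold `Z ∪ h` possesses PC
structure. … the defect `D(h²)` … is a number `max{f + 1 - tb(K), 0}`. If we have several
2-handles `h₁², …, hₙ²` attached to a Legendrian link on the boundary of PC manifold `Z`, then
the defect … is a sum of the defects of individual handles. So if the defect is zero, the PC
structure extends over 2-handles."*  Gompf (1998), Thm. 1.3 (Eliashberg): *"A smooth, oriented,
compact 4-manifold `X` admits a Stein structure if and only if it has a handle decomposition
satisfying (a) each handle has index `≤ 2`, (b) each 2-handle `hᵢ` is attached along a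
Legendrian curve `Kᵢ` in the contact structure induced on the boundary of the underlying 0- and
1-handles, and (c) the framing for attaching each `hᵢ` is obtained from the canonical framing on
`Kᵢ` by adding a single left (negative) twist."*

## Contents

* `Gompf1998_thm13_twoHandles` (**E2**, named fact) — the second bullet of AM Thm. 2 / the "if"
  direction of Gompf Thm. 1.3 (b)–(c), in the generality in which AM §3 invoke it ("`Z` a PC
  manifold … by a theorem of Eliashberg, `Z ∪ h` possesses PC structure"): `W` compact with a
  Stein structure `S`, finitely many 2-handles attached simultaneously to `W` along attaching
  maps `h i` (`IsMultiAttachment h P`) whose attaching circles are Legendrian for `S.J` and whose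
  handle framings have twisting number `-1` ("`tb - 1`", one left twist added to the canonical
  framing) ⟹ `P` admits a Stein structure (`IsSteinDomain P`).  Companion of
  `Gompf1998_thm13_noTwoHandles` (E1, `SteinHandlebodies.lean`).
* proved conveniences: the one-handle form `Gompf1998_thm13_twoHandles.single` (index type
  `Unit`), `defect_eq_zero_of_twisting_eq_neg_one` (the framing hypothesis of E2 is the case of
  equality of "defect `0`"), `isBoundaryLink_attachingCircle` (the attaching circles of a
  Legendrian multi-attachment form a link in `∂W`); the vacuous no-handle form is not asserted
  (it would need transport of Stein structures along diffeomorphisms).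

## The defect-zero criterion (D): merged back into E2 (review D-0026, 2026-08-15)

AM §3 continue the quotation above with *"the defect `D(h²)` of a 2-handle `h²` attached to a
Legendrian knot `K` on the boundary of PC manifold with framing `f` is a number
`max{f + 1 - tb(K), 0}`. … So if the defect is zero, the PC structure extends over 2-handles."*
This consequence **D** was formerly recorded in this file as a second named fact,
`AkbulutMatveyev1998_defectZero` — the statement of E2 verbatim with the framing hypothesis
`S.twisting … = -1` relaxed to `S.defect (h i).attachingCircle (h i).attachingFraming = 0`
(twisting `≤ -1`, `SteinStructure.defect_eq_zero_iff`) — together with the one-line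
`D ⟹ E2` (`Gompf1998_thm13_twoHandles_of_defectZero`) and `AkbulutMatveyev1998_defectZero.single`.
In print D is not a distinct result but the two-sentence corollary of Eliashberg's theorem
quoted above (stabilise until `tb = f + 1`, then apply E2), and that derivation is **proved** in
the tree from E2, ST (`Gompf1998_addLeftTwists`) and ISO
(`HandleAttachingMap.isMultiAttachment_of_linkIsotopyInBoundary`), all further inputs (TUBE, TH,
orientability of Stein domains, handle framings are knot framings, attaching circles are knots
in `∂W`) being theorems: `AkbulutMatveyev1998_defectZero_of_facts` (`DefectZeroProofs.lean`) and
`AkbulutMatveyev1998_defectZero_of_E2_ST_ISO`, `AkbulutMatveyev1998_defectZero_iff_thm13_twoHandles`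
(D ⟺ E2 under ST, ISO; `DefectZeroOfEliashberg.lean`, where the former rendering is displayed
verbatim as the left-hand side).  As a named fact D therefore only re-counted E2's debt (its
proving seat could do nothing but wait for E2), and under the fact-decomposition discipline
(D-0026: decomposition children are distinct M-sized published results; decompositions do not
recurse) it has been **merged back**: consumers take
`AkbulutMatveyev1998_defectZero_of_E2_ST_ISO hE hST hISO` (same binders as the former `hD`), and
the proof obligation of the parent `AkbulutMatveyev1998_thm3` meets D in that form.

## Review of E2 under the fact-decomposition discipline (D-0026, 2026-08-15): kept

E2's proving seat triaged it XL, so the fact came up for review as a decomposition child of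
`akbulut_matveyev` (is it provable inline, mis-cut, or not in the sources?).  Findings, with the
sources open (Gompf 1998, arXiv:math/9803019: Thm. 1.3 and the paragraph following it, and the
introduction, *"Implicit in the same paper [Eliashberg 1990] is a theorem in the `n = 2` case
(which is also due to Eliashberg … but not explicitly published). We state it as Theorem 1.3"*;
Akbulut–Matveyev 1998, arXiv:math/0010166: Thm. 2 and §3, p. 4):

* **In the sources, faithfully rendered.**  Hypotheses and conclusion are the printed ones
  through the dictionary above, in the generality of AM §3 (arbitrary PC base; see the
  docstring of the fact); the conclusion (`IsSteinDomain P`, existence) is weaker than print.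
  The hypotheses are realised in the tree — the doubly left-twisted unknot handle on `B⁴` is a
  Legendrian attachment of twisting `-1` (`SteinBallHandleTwisted.lean`,
  `isSteinDomain_of_isMultiAttachment_twistedUnknot`) — so the fact is not vacuous, and `P`
  needs no separate Hausdorff hypothesis (a multi-attachment carries the identification
  topology of Kosinski's gluing).  Not mis-stated, not an open problem: nothing to restate.
* **Not mis-cut.**  E2 is the distinct published result of this layer — the theorem both
  sources name after Eliashberg — not a slice of the parent's proof; its own corollary D has
  been merged into it (previous section), and it is consumed by name in `DefectZeroProofs.lean`,
  `DefectZeroOfEliashberg.lean`, `TwistingHomotopyProofs.lean` and `SteinBallHandleTwisted.lean`.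
* **Irreducibly XL, hence kept as a named fact and not a candidate for an inline proof or for
  further decomposition.**  The printed proof (Gompf, loc. cit.: *"Eliashberg proves this
  theorem by explicit holomorphic gluing. Each 2-handle is given as a neighborhood of
  `D² × 0 ⊂ iℝ² × ℝ² = ℂ²`. … The attaching circle `S¹ × 0` is glued to the given Legendrian
  curve"*) needs, none of it in Mathlib or the tree: (i) a holomorphic identification of a
  neighbourhood in `W` of each Legendrian attaching circle with a neighbourhood of `S¹ × 0` in a
  strictly pseudoconvex model hypersurface of `ℂ²` — complex-analytic geometry of strictly
  pseudoconvex boundaries and real-analytic approximation of Legendrian curves, for the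
  integrable `S.J` of the tree's `SteinStructure` (which is Gompf's *"compact, complex `X` with
  boundary … [admitting] a strictly plurisubharmonic function such that the boundary `∂X` is a
  level set"*, Introduction); (ii) strictly plurisubharmonic model functions on the standard handle
  and the `J`-convex surgery of the level hypersurface `∂W` along the Legendrian circle, which
  is where `n = 2` forces the framing `tb - 1` (Gompf: *"when `n = 2`, there is a serious
  restriction on the allowable framings"*); (iii) smoothing of corners and of maxima of
  `J`-convex functions, to present `∂P` as a regular maximal level set; (iv) transport of the
  resulting structure to the abstract attachment `P` — the one step the tree has
  (`IsSteinDomain.of_diffeomorph`, `SteinDomainDiffeomorph.lean`; uniqueness of gluings up to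
  diffeomorphism, `IsOpenGluing.nonempty_diffeomorph`).  Items (i)–(iii) are chapters of the
  theory of `J`-convex functions (Eliashberg 1990; Cieliebak–Eliashberg 2012), not M-sized
  published lemmas with their own locators, so no admissible decomposition of E2 exists below
  this file; E2 stays its single named fact.

## What this fact does NOT say (scope)

* Only existence of *a* Stein structure on `P` is asserted (`IsSteinDomain`), not that it
  extends `S` (AM: "the complex structure on `X₁` can be extended"); the tree's `IsSteinDomain`
  cannot express the extension, and Theorem 3 of AM only needs PC-ness of the pieces.
* Orientations: Gompf's `X` is oriented and the left twist is measured in `∂X₁` with its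
  boundary orientation from the complex orientation; `SteinStructure.twisting` is intrinsic to
  `S` (frame `(J ċ, R)`, `α(R) > 0`) and was checked against this convention on `∂B⁴`
  (`twisting_legendrianUnknot_seifertFraming = 1`, `SteinBallLegendrian.lean`), so "framing
  `tb - 1`" is `twisting = -1` with no further orientation datum.
* The converse direction of Gompf Thm. 1.3 (every compact Stein surface arises this way) and the
  deformation statements are not recorded.

## References

* S. Akbulut, R. Matveyev, *A convex decomposition theorem for 4-manifolds*, IMRN 1998, no. 7,
  371–381 (arXiv:math/0010166), Thm. 2 and §3. [AkbulutMatveyev1998]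
* R. E. Gompf, *Handlebody construction of Stein surfaces*, Ann. of Math. 148 (1998), 619–693,
  Thm. 1.3 and the paragraph following it ("`iτ` goes to the canonical framing … differs from
  the product framing by one twist … left-handed"). [Gompf1998]
* Ya. Eliashberg, *Topological characterization of Stein manifolds of dimension > 2*, Internat.
  J. Math. 1 (1990), 29–46 (the theorem both sources attribute the result to). [Eliashberg1990Stein]
* K. Cieliebak, Ya. Eliashberg, *From Stein to Weinstein and Back: Symplectic Geometry of Affine
  Complex Manifolds*, AMS Colloquium Publ. 59 (2012) (the monograph account of `J`-convex
  functions and of Stein handle attachment). [CieliebakEliashberg2012]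
* A. A. Kosinski, *Differential Manifolds* (1993), VI §6 (attaching handles). [Kosinski1993]
-/

noncomputable section

open scoped Manifold ContDiff Topology
open Set Function

namespace Literature.Geometry.Symplectic

open Literature.Topology.FourManifolds

/-- The model vector space `ℝ⁴` of the tangent spaces. [folklore] -/
local notation "E4" => EuclideanSpace ℝ (Fin 4)

/-- Local notation: `𝕊 n` is the unit sphere in `EuclideanSpace ℝ (Fin (n + 1))`. -/
local notation "𝕊 " n:arg => (Metric.sphere (0 : EuclideanSpace ℝ (Fin (n + 1))) 1)

/-! ### The named fact -/

/-- **Eliashberg's theorem, part II (Gompf 1998, Thm. 1.3 (b)–(c); Akbulut–Matveyev 1998,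
Thm. 2 (2) and §3).**  Let `W` be a compact (Hausdorff) smooth 4-manifold with boundary
carrying a Stein structure `S`, and let `P` be `W` with finitely many 2-handles attached
simultaneously along attaching maps `h i : T → W` with pairwise disjoint ranges
(`HandleAttachingMap.IsMultiAttachment`, Kosinski's `W ∪ H² ∪ ⋯ ∪ H²`).  If every attaching
circle `(h i).attachingCircle : S¹ → ∂W` is a Legendrian knot for the complex tangencies of `S`
(`IsLegendrianKnot S.J`) and the framing induced by every handle (`(h i).attachingFraming`, the
product framing `f(S¹ × e₁)`) has twisting number `-1` relative to the canonical framing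
(`SteinStructure.twisting`; "framing one less than Thurston–Bennequin", "obtained from the
canonical framing by adding a single left twist"), then `P` admits a Stein structure:
*"by a theorem of Eliashberg, manifold `Z ∪ h` possesses PC structure"*.  Only the existence of
a Stein structure on `P` is recorded (see the module docstring for what is not).  Generality:
Gompf's printed (b)–(c) have base `X₁ = B⁴ ∪ 1-handles` with its standard structure (so does AM
Thm. 2 (2)); the form with an arbitrary PC (Stein) base `(W, S)` recorded here is the one
Akbulut–Matveyev state and use in §3 (*"Let `Z` be a PC manifold and `h` be a two handle
attached to `∂Z` along a Legendrian knot … by a theorem of Eliashberg, manifold `Z ∪ h`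
possesses PC structure"*, p. 4 of arXiv:math/0010166), both sources attributing it to
Eliashberg (1990). [cite: Gompf1998, Thm. 1.3] [cite: AkbulutMatveyev1998, §3] -/
def Gompf1998_thm13_twoHandles : Prop :=
  ∀ (W P : Type) [TopologicalSpace W] [T2Space W] [ChartedSpace (EuclideanHalfSpace 4) W]
    [IsManifold (𝓡∂ 4) ∞ W] [CompactSpace W] [TopologicalSpace P]
    [ChartedSpace (EuclideanHalfSpace 4) P] [IsManifold (𝓡∂ 4) ∞ P] [CompactSpace P]
    (S : SteinStructure W) (ι : Type) [Finite ι] (h : ι → HandleAttachingMap 3 2 W),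
    HandleAttachingMap.IsMultiAttachment h (𝓡∂ 4) P →
    (∀ i, IsLegendrianKnot S.J (h i).attachingCircle) →
    (∀ i, S.twisting (h i).attachingCircle (h i).attachingFraming = -1) →
    IsSteinDomain P

/-! ### Proved special cases -/

section Single

variable {W P : Type} [TopologicalSpace W] [T2Space W] [ChartedSpace (EuclideanHalfSpace 4) W]
  [IsManifold (𝓡∂ 4) ∞ W] [CompactSpace W] [TopologicalSpace P]
  [ChartedSpace (EuclideanHalfSpace 4) P] [IsManifold (𝓡∂ 4) ∞ P] [CompactSpace P]

/-- **One 2-handle (AM §3: "`Z ∪ h` possesses PC structure").**  Under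
`Gompf1998_thm13_twoHandles`: a single 2-handle attached to a Stein `W` along a Legendrian knot
with framing `tb - 1` gives a Stein `P` (index type `Unit`). [cite: AkbulutMatveyev1998, §3] -/
theorem Gompf1998_thm13_twoHandles.single (hE : Gompf1998_thm13_twoHandles) (S : SteinStructure W)
    (h₁ : HandleAttachingMap 3 2 W)
    (hP : HandleAttachingMap.IsMultiAttachment (fun _ : Unit => h₁) (𝓡∂ 4) P)
    (hLeg : IsLegendrianKnot S.J h₁.attachingCircle)
    (htw : S.twisting h₁.attachingCircle h₁.attachingFraming = -1) : IsSteinDomain P :=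
  hE W P S Unit (fun _ => h₁) hP (fun _ => hLeg) fun _ => htw

omit [T2Space W] in
/-- The framing hypothesis of E2 in terms of the defect: twisting `-1` means defect `0` (and
conversely defect `0` means twisting `≤ -1`) — the case of equality of AM's defect-zero
criterion (merged back into E2, see the module docstring). [cite: AkbulutMatveyev1998, §3] -/
theorem defect_eq_zero_of_twisting_eq_neg_one (S : SteinStructure W) {K : 𝕊 1 → W} {ν : 𝕊 1 → E4}
    (h : S.twisting K ν = -1) : S.defect K ν = 0 :=
  (S.defect_eq_zero_iff K ν).2 (le_of_eq h)

omit [IsManifold (𝓡∂ 4) ∞ P] [CompactSpace P] in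
/-- The attaching circles of a multi-attachment along a Legendrian family form a link in `∂W`
(components are knots in `∂W`, and distinct attaching maps have disjoint ranges, hence disjoint
attaching circles) — the "Legendrian link on the boundary of PC manifold `Z`" of AM §3.
[cite: AkbulutMatveyev1998, §3] -/
theorem isBoundaryLink_attachingCircle {ι : Type} [Finite ι] (S : SteinStructure W)
    {h : ι → HandleAttachingMap 3 2 W} (hP : HandleAttachingMap.IsMultiAttachment h (𝓡∂ 4) P)
    (hLeg : ∀ i, IsLegendrianKnot S.J (h i).attachingCircle) :
    IsBoundaryLink fun i => (h i).attachingCircle := by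
  refine ⟨fun i => (hLeg i).isBoundaryKnot, fun i j hij => ?_⟩
  refine Set.disjoint_left.2 fun a ⟨θ, hθ⟩ ⟨θ', hθ'⟩ => ?_
  have hdis := hP.1 hij
  refine Set.disjoint_left.1 hdis ⟨coreTubePt θ, hθ⟩ ⟨coreTubePt θ', hθ'⟩

end Single

end Literature.Geometry.Symplectic

end
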